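import Literature.NumberTheory.EllipticCurves.SelmerPInftyRestriction
import Literature.NumberTheory.EllipticCurves.SelmerCorankProofs
import Literature.NumberTheory.EllipticCurves.PointDivisibilityProofs
import Literature.NumberTheory.EllipticCurves.BSDSelmerParityDokchitserBaseChangeProofs
import Literature.NumberTheory.GaloisRepresentations.LocalGlobalCohomologyFiniteProofs
import Summits.BirchSwinnertonDyer.BirchSwinnertonDyer.Theorems.ByReductionTypeAtTwoSupersingularFlatBlindTwistSideLattice
import Summits.BirchSwinnertonDyer.BirchSwinnertonDyer.Theorems.ThetaPartnerAtTwoSignedControlAtTwoCorankGrowth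
import HarnessLib

/-!
# Route `ByReductionTypeAtTwo` (rung K4), crux `SupersingularRankZeroAtTwo` (item stmt-BirchSwinnertonDyer-19097), hand hK87-C
# (-imc's K87-C `BlindZeroOfTwistSelmerCorankAtTwo`), step (S1): **the `v`-STRICT part of `Sel_{p^∞}(E/ℚ)` has corank
# `≥ corank Sel_{p^∞}(E/ℚ) − 1`** — in the finite form «if `Sel_{p^∞}(E/ℚ) ∩ ker(res_v)` is finite then
# `corank_{ℤ_p} Sel_{p^∞}(E/ℚ) ≤ 1`» (cell `bsd-2adic`, seat `bsd-2adic-t42` GEN 46; `--supports 19097`, helper)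

HONEST FRAMING (D-0036/D-0054): THEOREMS ONLY (no definition, no named fact, no `sorry`, no instance). Nothing about any
particular curve is asserted; 19097 OPEN; BSD proved for no curve. This is the LOCAL dictionary of -imc's mechanism (D87
§1, step (S1): «the kernel of `loc₂` on `Sel_{2^∞}(W₂/ℚ)` has corank `≥ corank − 1`, since `W₂(ℚ₂) ⊗ ℚ₂/ℤ₂` has corank
`1`»), PROVED for every elliptic curve over `ℚ`, every prime `p` and the place `v ∋ p`:

* §1 (any perfect field `F`, any elliptic `V/F` whose Mordell–Weil group has a finite-index subgroup `U ≃ ℤ_p`):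
  **`#{c ∈ ker(H¹(F, V[p^∞]) → H¹(F, V)) : p^k c = 0} ≤ [V(F) : U] · p^k`** (`natCard_kummerTorsion_le`): such a
  class is a Kummer class `κ(P ⊗ p^{-N})` (tree `range_kummerMapPInfty`), and `p^k κ_N(P) = 0` forces it into the
  image of the level-`k` Kummer map `κ_k : V(F) → H¹(F, V[p^∞])` (tree `exists_of_kummerMapLevel_eq_zero`,
  `kummerMapLevel_level`), whose kernel contains `p^k U` of index `[V(F):U]·p^k` (tree
  `FlatBlindTwistSide.index_range_comp_subtype_eq`).
* §2 (any number field `K`): a Selmer class is locally Kummer at `v`: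
  `primaryH1ToH1 (W ⊗ K_v) (res_v s) = 0` (`primaryH1ToH1_resPrimary_eq_zero_of_mem_selmerGroupPInfty`; tree
  `selmerGroupPInfty_eq_comap_sha`, `primaryH1ToH1_resPrimary`, `mem_ker_resBaseChange_iff`).
* §3 (`K = ℚ`, `v ∋ p`): **`Sel_{p^∞}(E/ℚ) ∩ ker res_v` finite ⟹ `corank_{ℤ_p} Sel_{p^∞}(E/ℚ) ≤ 1`**
  (`selmerCorank_le_one_of_finite_strictAt`): `p^{k·corank} ≤ #Sel[p^k] ≤ #(Sel ∩ ker res_v) · [E(ℚ_v):U] · p^k`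
  (tree `SignedEC.H1SigmaCorank.zpCorank_le_of_natCard_torsionBy_pow_le`, Silverman VII.6.3 in the tree's form
  `FlatBlindTwistSide.exists_finiteIndex_addEquiv_padicInt_adicCompletion`).

References: [GreenbergLNM1716] §1 p. 55, §2 pp. 62–63 (the `p^∞` Kummer sequence, coranks); [SilvermanAEC2009]
Prop. VII.6.3, VIII §2; [Skinner2020] §2.2 (the strict Selmer group at `p`).
-/

set_option autoImplicit false
-- the Theorems namespace of this sub repeats the summit name by design (D-0017 nested layout)
set_option linter.dupNamespace false

noncomputable section

open scoped Classical AddSubgroup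

universe u

namespace Summit.BirchSwinnertonDyer.BirchSwinnertonDyer.Theorems

namespace BlindPinch

open WeierstrassCurve Literature.NumberTheory.EllipticCurves Literature.NumberTheory.GaloisRepresentations
  NumberField IsDedekindDomain

/-! ## §1 The `p^k`-torsion of the local Kummer image -/

section Local

variable {F : Type u} [Field F] [PerfectField F] (V : WeierstrassCurve F) [V.IsElliptic] (p : ℕ) [hp : Fact p.Prime]

/-- **A locally-Kummer class killed by `p^k` is a level-`k` Kummer class**: if `c ∈ ker(H¹(F, V[p^∞]) → H¹(F, V))`
and `p^k c = 0` then `c = κ_k(P)` for some `P ∈ V(F)` (`c = κ_N(Q)`, `κ_N(p^k Q) = 0` gives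
`p^{m+k} Q = p^{N+m} P`, and `κ_N(Q) = κ_{N+m+k}(p^{N+m} P) = κ_k(P)`). [cite: GreenbergLNM1716, §2 pp. 62–63] -/
theorem mem_range_kummerMapLevel_of_primaryH1ToH1_eq_zero (hdiv : V.zsmul_geomPoints_surjective) (k : ℕ)
    {c : galH1Primary V p} (hc : primaryH1ToH1 V p c = 0) (hk : p ^ k • c = 0) :
    c ∈ (kummerMapLevel V p hdiv k).range := by
  have hmem : c ∈ (kummerMapPInfty V p hdiv).range := by
    rw [range_kummerMapPInfty]; exact hc
  obtain ⟨t, rfl⟩ := hmem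
  obtain ⟨Q, N, rfl⟩ := exists_eq_tmul_prufGen V p t
  rw [kummerMapPInfty_tmul_prufGen] at hk ⊢
  have h0 : kummerMapLevel V p hdiv N (p ^ k • Q) = 0 := by rw [map_nsmul, hk]
  obtain ⟨m, P, hP⟩ := exists_of_kummerMapLevel_eq_zero V p hdiv N (p ^ k • Q) h0
  refine ⟨P, ?_⟩
  rw [← kummerMapLevel_level V p hdiv N (m + k) (N + (m + k)) rfl Q, pow_add, mul_smul, hP,
    kummerMapLevel_level V p hdiv k (N + m) (N + (m + k)) (by ring) P]

/-- **`#{c ∈ ker(H¹(F, V[p^∞]) → H¹(F, V)) : p^k c = 0} ≤ [V(F) : U] · p^k`** for a finite-index subgroup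
`U ≃ ℤ_p` of `V(F)`: such classes lie in the image of `κ_k`, whose kernel contains `p^k U`, of index `[V(F):U]·p^k`.
For `F = ℚ_p` this is «`E(ℚ_p) ⊗ ℚ_p/ℤ_p` has `ℤ_p`-corank `1`». [cite: GreenbergLNM1716, §2 pp. 62–63]
[cite: SilvermanAEC2009, Prop. VII.6.3] -/
theorem natCard_kummerTorsion_le (U : AddSubgroup V.toAffine.Point) [U.FiniteIndex] (e : U ≃+ ℤ_[p]) (k : ℕ) :
    Set.Finite {c : galH1Primary V p | primaryH1ToH1 V p c = 0 ∧ p ^ k • c = 0} ∧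
      Nat.card {c : galH1Primary V p | primaryH1ToH1 V p c = 0 ∧ p ^ k • c = 0} ≤ U.index * p ^ k := by
  have hdiv : V.zsmul_geomPoints_surjective := V.zsmul_geomPoints_surjective_holds
  set κk := kummerMapLevel V p hdiv k with hκk
  -- `p^k U ≤ ker κ_k`
  set L : AddSubgroup V.toAffine.Point := ((zsmulAddGroupHom ((p : ℤ) ^ k) : _ →+ _).comp U.subtype).range with hL
  have hLker : L ≤ κk.ker := by
    rintro _ ⟨u, rfl⟩
    rw [AddMonoidHom.mem_ker, AddMonoidHom.comp_apply, zsmulAddGroupHom_apply, AddSubgroup.coe_subtype,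
      ← Nat.cast_pow, natCast_zsmul, hκk, kummerMapLevel_nsmul_self]
  have hLidx : L.index = U.index * p ^ k := FlatBlindTwistSide.index_range_comp_subtype_eq p U e k
  have hidx : κk.ker.index ∣ U.index * p ^ k := hLidx ▸ AddSubgroup.index_dvd_of_le hLker
  have hne : U.index * p ^ k ≠ 0 := mul_ne_zero AddSubgroup.FiniteIndex.index_ne_zero (pow_ne_zero k hp.out.ne_zero)
  have hcard : Nat.card κk.range ≤ U.index * p ^ k := by
    rw [← AddSubgroup.index_ker]
    exact Nat.le_of_dvd (Nat.pos_of_ne_zero hne) hidx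
  have hfin : (κk.range : Set (galH1Primary V p)).Finite := by
    have h0 : Nat.card κk.range ≠ 0 := by
      rw [← AddSubgroup.index_ker]
      exact fun h ↦ hne (Nat.eq_zero_of_zero_dvd (h ▸ hidx))
    exact (Nat.finite_of_card_ne_zero h0)
  have hsub : {c : galH1Primary V p | primaryH1ToH1 V p c = 0 ∧ p ^ k • c = 0} ⊆ (κk.range : Set (galH1Primary V p)) :=
    fun c hc ↦ mem_range_kummerMapLevel_of_primaryH1ToH1_eq_zero V p hdiv k hc.1 hc.2
  exact ⟨hfin.subset hsub, (Nat.card_mono hfin hsub).trans hcard⟩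

end Local

/-! ## §2 Selmer classes are locally Kummer at `v` -/

section Selmer

variable {K : Type u} [Field K] [NumberField K] (W : WeierstrassCurve K) (p : ℕ) (v : HeightOneSpectrum (𝓞 K))

/-- **A `p^∞`-Selmer class is locally Kummer at `v`**: its restriction to `K_v` dies in `H¹(K_v, E)`, i.e. lies in
`ker(H¹(K_v, E[p^∞]) → H¹(K_v, E))` (the Selmer condition at `v`, transported along `primaryH1ToH1_resPrimary`).
[cite: GreenbergLNM1716, §2 p. 63] -/
theorem primaryH1ToH1_resPrimary_eq_zero_of_mem_selmerGroupPInfty {s : galH1Primary W p}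
    (hs : s ∈ selmerGroupPInfty W p) :
    primaryH1ToH1 (W.baseChange (v.adicCompletion K)) p (resPrimary W (v.adicCompletion K) p s) = 0 := by
  rw [primaryH1ToH1_resPrimary, mem_ker_resBaseChange_iff]
  rw [selmerGroupPInfty_eq_comap_sha, AddSubgroup.mem_comap] at hs
  exact ((W.mem_sha_iff _).mp hs).1 v

end Selmer

/-! ## §3 `Sel ∩ ker res_v` finite ⟹ `corank Sel_{p^∞}(E/K) ≤ 1` -/

section Corank

variable {K : Type} [Field K] [NumberField K] (W : WeierstrassCurve K) [W.IsElliptic] (p : ℕ) [hp : Fact p.Prime]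
  (v : HeightOneSpectrum (𝓞 K))

/-- **If `E(K_v)` has a finite-index subgroup `U ≃ ℤ_p` and the `v`-strict part
`Sel_{p^∞}(E/K) ∩ ker(res_v : H¹(K, E[p^∞]) → H¹(K_v, E[p^∞]))` is finite, then `corank_{ℤ_p} Sel_{p^∞}(E/K) ≤ 1`**
(any number field `K`, any finite place `v`): `p^{k·corank} ≤ #Sel[p^k]` (`pow_mul_zpCorank_le_natCard_torsionBy_pow`),
while `res_v` maps `Sel[p^k]`, with kernel inside the finite strict part, into the `p^k`-torsion of the local Kummer image,
of order `≤ [E(K_v):U]·p^k` (§1). [cite: GreenbergLNM1716, §1 p. 55 and §2 pp. 62–63] [cite: Skinner2020, §2.2] -/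
theorem selmerCorank_le_one_of_finite_strictAt_of_lattice
    (U : AddSubgroup (W.baseChange (v.adicCompletion K)).toAffine.Point) [U.FiniteIndex] (e : U ≃+ ℤ_[p])
    (hfin : Finite ↥(selmerGroupPInfty W p ⊓ (resPrimary W (v.adicCompletion K) p).ker)) :
    W.selmerCorank p ≤ 1 := by
  haveI : CharZero (v.adicCompletion K) := charZero_adicCompletion v
  haveI : (W.baseChange (v.adicCompletion K)).IsElliptic := by rw [baseChange]; infer_instance
  set S := selmerGroupPInfty W p with hS
  set S' := S ⊓ (resPrimary W (v.adicCompletion K) p).ker with hS'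
  haveI : Finite S' := hfin
  haveI : Finite S[(p : ℤ)] := finite_torsionBy_selmerGroupPInfty W p
  have hA : ∀ a : S, ∃ n : ℕ, p ^ n • a = 0 := fun a ↦ by
    obtain ⟨n, hn⟩ := exists_pow_nsmul_eq_zero_galH1Primary W p (a : galH1Primary W p)
    exact ⟨n, Subtype.ext (by rw [AddSubmonoidClass.coe_nsmul, hn, ZeroMemClass.coe_zero])⟩
  change zpCorank S p ≤ 1
  refine SignedEC.H1SigmaCorank.zpCorank_le_of_natCard_torsionBy_pow_le hA (C := Nat.card S' * U.index) (s := 1)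
    fun k ↦ ?_
  -- `res_v` on `Sel[p^k]`
  let f : S[((p ^ k : ℕ) : ℤ)] →+ galH1Primary (W.baseChange (v.adicCompletion K)) p :=
    (resPrimary W (v.adicCompletion K) p).comp (S.subtype.comp (S[((p ^ k : ℕ) : ℤ)]).subtype)
  have hf : ∀ x : S[((p ^ k : ℕ) : ℤ)], f x = resPrimary W (v.adicCompletion K) p ((x : S) : galH1Primary W p) :=
    fun _ ↦ rfl
  -- its kernel embeds into the strict part
  have hker : Nat.card f.ker ≤ Nat.card S' := by
    refine Nat.card_le_card_of_injective (fun x : f.ker ↦ (⟨(((x : S[((p ^ k : ℕ) : ℤ)]) : S) : galH1Primary W p),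
      AddSubgroup.mem_inf.mpr ⟨((x : S[((p ^ k : ℕ) : ℤ)]) : S).2, ?_⟩⟩ : S')) ?_
    · rw [AddMonoidHom.mem_ker, ← hf]
      exact (AddMonoidHom.mem_ker).mp x.2
    · intro x y h
      apply Subtype.ext; apply Subtype.ext; apply Subtype.ext
      exact congrArg (fun z : S' ↦ (z : galH1Primary W p)) h
  -- its image lies in the `p^k`-torsion of the local Kummer image
  obtain ⟨hTfin, hTcard⟩ := natCard_kummerTorsion_le (W.baseChange (v.adicCompletion K)) p U e k
  have hrange : (f.range : Set (galH1Primary (W.baseChange (v.adicCompletion K)) p)) ⊆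
      {c | primaryH1ToH1 (W.baseChange (v.adicCompletion K)) p c = 0 ∧ p ^ k • c = 0} := by
    rintro _ ⟨x, rfl⟩
    refine ⟨?_, ?_⟩
    · rw [hf]
      exact primaryH1ToH1_resPrimary_eq_zero_of_mem_selmerGroupPInfty W p v ((x : S).2)
    · rw [← map_nsmul]
      have hx : p ^ k • (x : S) = 0 := AddSubgroup.torsionBy.nsmul_iff.mp x.2
      have hx' : p ^ k • x = 0 := Subtype.ext (by rw [AddSubmonoidClass.coe_nsmul, hx]; rfl)
      rw [hx', map_zero]
  have hrangeCard : Nat.card f.range ≤ U.index * p ^ k := (Nat.card_mono hTfin hrange).trans hTcard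
  -- count
  calc Nat.card S[((p ^ k : ℕ) : ℤ)] = Nat.card f.ker * Nat.card f.range := by
        rw [← AddSubgroup.index_ker, AddSubgroup.card_mul_index]
    _ ≤ Nat.card S' * (U.index * p ^ k) := Nat.mul_le_mul hker hrangeCard
    _ = Nat.card S' * U.index * p ^ (1 * k) := by rw [one_mul, mul_assoc]

/-- **Over `ℚ` at the place `v ∋ p`: `Sel_{p^∞}(E/ℚ) ∩ ker res_v` finite ⟹ `corank_{ℤ_p} Sel_{p^∞}(E/ℚ) ≤ 1`**
(the lattice `U ≅ ℤ_p ≤ E(ℚ_v)` of finite index is Silverman VII.6.3, tree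
`FlatBlindTwistSide.exists_finiteIndex_addEquiv_padicInt_adicCompletion`). The corank form of -imc's step (S1):
«the kernel of `loc_v` on `Sel_{p^∞}(E/ℚ)` has corank `≥ corank − 1`».
[cite: SilvermanAEC2009, Prop. VII.6.3] [cite: GreenbergLNM1716, §1 p. 55 and §2 pp. 62–63] -/
theorem selmerCorank_le_one_of_finite_strictAt (W : WeierstrassCurve ℚ) [W.IsElliptic] (v : HeightOneSpectrum (𝓞 ℚ))
    (hv : (p : 𝓞 ℚ) ∈ v.asIdeal)
    (hfin : Finite ↥(selmerGroupPInfty W p ⊓ (resPrimary W (v.adicCompletion ℚ) p).ker)) :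
    W.selmerCorank p ≤ 1 := by
  obtain ⟨U, hU, ⟨e⟩⟩ := FlatBlindTwistSide.exists_finiteIndex_addEquiv_padicInt_adicCompletion W p v hv
  haveI := hU
  exact selmerCorank_le_one_of_finite_strictAt_of_lattice W p v U e hfin

end Corank

end BlindPinch

end Summit.BirchSwinnertonDyer.BirchSwinnertonDyer.Theorems

end
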